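import Summits.AtomisticToContinuum.HydrodynamicLimit.Theorems.EquilibriumClampedCollisionalWindowLD.Negative.MainBound
import Summits.AtomisticToContinuum.HydrodynamicLimit.Theorems.EquilibriumClampedCollisionalWindowLD.Negative.FinalIneq2

/-!
# Negative lemma for crux `TwoClocks.ClampedTransferWindowLD` (stmt-AtomisticToContinuum-16623): the clamp level `V` must be fixed BEFORE the window length `τ` — the natural strengthening "clamp after window" (`… ∀τ ∃V₀ ∀V …`, `β₀` before both) is FALSE
With the TRANSFER activity of C′, a relay sphere of the frozen line-lattice Newton cradle (refutation of stmt-13733, landed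
`Negative/*` modules) has activity `≤ (σ/τ)(2V_hi + 3V_hi²) ≍ σt²` (`τ = t⁴`, pulse speed `V_hi ≍ t³`; `transferImpulseSum_le`):
C′'s clamp switches the cradle off at every FIXED `V` (why C′ resists), but a clamp level chosen after `τ` does not, and the landed
gain/cost bookkeeping (gain `≍ β(N+1)t²/l²` vs `(N+1)(216 log t + C)`) refutes the reordered statement verbatim. Moral for provers:
`β₀(V)·V` must stay bounded up to logarithms; `τ₀` cannot be uniform in `V`. No Theses declaration is asserted positively
(Negative/ lane, `--supports`). refuter-cdisprove-stmt-AtomisticToContinuum-16623-0, 2026-08-16; crux workfile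
`Cruxes/ClampedTransferWindowLD/Disproof.lean`.
-/

noncomputable section

open Real
open scoped InnerProductSpace

namespace Summit.AtomisticToContinuum.HydrodynamicLimit.Theorems.ClampedTransferWindowLDNegative

open Summit.AtomisticToContinuum.HydrodynamicLimit.Theorems
open Summit.AtomisticToContinuum.HydrodynamicLimit.Theorems.EquilibriumClampedCollisionalWindowLDNegative
open Summit.AtomisticToContinuum.HydrodynamicLimit.Theorems.EquilibriumClampedCollisionalWindowLDNegative.Lat
open MeasureTheory Literature.Analysis.FluidPDE Literature.Analysis.FunctionSpaces Literature.MathematicalPhysics.KineticTheory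

section TransferClamp

variable {Λ : EquilibriumClampedCollisionalWindowLDNegative.Lat} {N : ℕ} {a : Fin (N + 1) ≃ Λ.Slot}
variable {Φ : HardSphereFlow (Torus.geometry (Fin 3)) Λ.P.ε (N + 1)}

/-- **Transfer-activity values of the two records of a transfer**: both are `≤ V_hi + (3/2) V_hi²` (momentum impulse
`c ≤ V_hi`; energy impulses `|c² − 2c⟨W,n⟩|/2 ≤ (3/2)V_hi²` and `|2c⟨η,n⟩ + c²|/2 ≤ (3/2) V_hi²`). [folklore] -/
theorem transferValue_le (hW : Λ.WinOK) {z : Cfg N} (hz : z ∈ Λ.Ev a) {tr : ℕ × (Fin Λ.n × Fin Λ.n) × ℕ}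
    (htr : tr ∈ Λ.transfers a z) :
    let rIJ := HardSphereCollisionRecord.ofConfig (Torus.geometry (Fin 3)) Λ.P.ε (Λ.cert a z (Λ.ttime a z tr))
        (Λ.ttime a z tr) (Λ.sphI a tr) (Λ.sphJ a tr)
    let rJI := HardSphereCollisionRecord.ofConfig (Torus.geometry (Fin 3)) Λ.P.ε (Λ.cert a z (Λ.ttime a z tr))
        (Λ.ttime a z tr) (Λ.sphJ a tr) (Λ.sphI a tr)
    (0 ≤ ‖rIJ.postVel.1 - rIJ.preVel.1‖ + |‖rIJ.postVel.1‖ ^ 2 - ‖rIJ.preVel.1‖ ^ 2| / 2 ∧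
      ‖rIJ.postVel.1 - rIJ.preVel.1‖ + |‖rIJ.postVel.1‖ ^ 2 - ‖rIJ.preVel.1‖ ^ 2| / 2 ≤
        Λ.P.Vhi + 3 / 2 * Λ.P.Vhi ^ 2) ∧
    (0 ≤ ‖rJI.postVel.1 - rJI.preVel.1‖ + |‖rJI.postVel.1‖ ^ 2 - ‖rJI.preVel.1‖ ^ 2| / 2 ∧
      ‖rJI.postVel.1 - rJI.preVel.1‖ + |‖rJI.postVel.1‖ ^ 2 - ‖rJI.preVel.1‖ ^ 2| / 2 ≤
        Λ.P.Vhi + 3 / 2 * Λ.P.Vhi ^ 2) := by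
  have hΛ := hW.ok
  have hP := hΛ.sep.adm
  obtain ⟨hb, hj, hact, -⟩ := mem_transfers.1 htr
  have hD := dataOK_of_mem hΛ hz hact tr.2.1
  have hf := stepFacts hP hD (by omega : tr.2.2 + 1 ≤ Λ.P.K)
  have hn1 : ‖Λ.trN a z tr‖ = 1 := hf.cont.n_unit
  obtain ⟨hc0, hcV⟩ := trC_le hΛ hz htr
  have hWV : ‖Λ.trW a z tr‖ ≤ Λ.P.Vhi := hf.W_le
  have hηu : ‖Λ.trη a z tr‖ ≤ Λ.P.u := hf.geom.η_le
  have huV : Λ.P.u ≤ Λ.P.Vhi := by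
    have := hP.V_pos; have := hP.u_nn; have := hP.dV_nn
    unfold Params.Vhi
    have : (0 : ℝ) ≤ (Λ.P.K : ℝ) * Λ.P.dV := by positivity
    linarith
  have hηV : ‖Λ.trη a z tr‖ ≤ Λ.P.Vhi := hηu.trans huV
  have hVhi0 : 0 ≤ Λ.P.Vhi := hP.Vhi_pos.le
  obtain ⟨hpi, hpj⟩ := preVel_transfer hW hz htr
  obtain ⟨hvi, hvj⟩ := cert_snd_transfer hW hz htr
  simp only [HardSphereCollisionRecord.ofConfig_postVel, hpi, hpj, hvi, hvj]
  set c := Λ.trC a z tr with hc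
  set n := Λ.trN a z tr with hn
  set W := Λ.trW a z tr with hWdef
  set η := Λ.trη a z tr with hηdef
  have h1 : ‖W - c • n - W‖ = c := by
    rw [show W - c • n - W = -(c • n) by abel, norm_neg, norm_smul, hn1, mul_one, Real.norm_of_nonneg hc0]
  have h2 : ‖η + c • n - η‖ = c := by
    rw [show η + c • n - η = c • n by abel, norm_smul, hn1, mul_one, Real.norm_of_nonneg hc0]
  have e1 : ‖W - c • n‖ ^ 2 - ‖W‖ ^ 2 = c ^ 2 - 2 * (c * ⟪W, n⟫_ℝ) := by
    rw [norm_sub_sq_real, real_inner_smul_right, norm_smul, hn1, mul_one, Real.norm_eq_abs, sq_abs]; ring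
  have e2 : ‖η + c • n‖ ^ 2 - ‖η‖ ^ 2 = 2 * (c * ⟪η, n⟫_ℝ) + c ^ 2 := by
    rw [norm_add_sq_real, real_inner_smul_right, norm_smul, hn1, mul_one, Real.norm_eq_abs, sq_abs]; ring
  have iW : |⟪W, n⟫_ℝ| ≤ Λ.P.Vhi := by
    have := abs_real_inner_le_norm W n; rw [hn1, mul_one] at this; exact this.trans hWV
  have iη : |⟪η, n⟫_ℝ| ≤ Λ.P.Vhi := by
    have := abs_real_inner_le_norm η n; rw [hn1, mul_one] at this; exact this.trans hηV
  have hc2 : c ^ 2 ≤ Λ.P.Vhi ^ 2 := pow_le_pow_left₀ hc0 hcV 2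
  have b1 : |c ^ 2 - 2 * (c * ⟪W, n⟫_ℝ)| ≤ 3 * Λ.P.Vhi ^ 2 := by
    have hx : |2 * (c * ⟪W, n⟫_ℝ)| ≤ 2 * Λ.P.Vhi ^ 2 := by
      rw [abs_mul, abs_mul, abs_of_nonneg hc0, abs_of_pos (by norm_num : (0:ℝ) < 2)]
      nlinarith [mul_le_mul hcV iW (abs_nonneg _) hVhi0]
    calc |c ^ 2 - 2 * (c * ⟪W, n⟫_ℝ)| ≤ |c ^ 2| + |2 * (c * ⟪W, n⟫_ℝ)| := abs_sub _ _
      _ ≤ Λ.P.Vhi ^ 2 + 2 * Λ.P.Vhi ^ 2 := add_le_add (by rw [abs_of_nonneg (sq_nonneg _)]; exact hc2) hx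
      _ = 3 * Λ.P.Vhi ^ 2 := by ring
  have b2 : |2 * (c * ⟪η, n⟫_ℝ) + c ^ 2| ≤ 3 * Λ.P.Vhi ^ 2 := by
    have hx : |2 * (c * ⟪η, n⟫_ℝ)| ≤ 2 * Λ.P.Vhi ^ 2 := by
      rw [abs_mul, abs_mul, abs_of_nonneg hc0, abs_of_pos (by norm_num : (0:ℝ) < 2)]
      nlinarith [mul_le_mul hcV iη (abs_nonneg _) hVhi0]
    calc |2 * (c * ⟪η, n⟫_ℝ) + c ^ 2| ≤ |2 * (c * ⟪η, n⟫_ℝ)| + |c ^ 2| := abs_add_le _ _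
      _ ≤ 2 * Λ.P.Vhi ^ 2 + Λ.P.Vhi ^ 2 := add_le_add hx (by rw [abs_of_nonneg (sq_nonneg _)]; exact hc2)
      _ = 3 * Λ.P.Vhi ^ 2 := by ring
  rw [h1, h2, e1, e2]
  refine ⟨⟨by positivity, ?_⟩, ⟨by positivity, ?_⟩⟩ <;> linarith

/-- **The transfer activity is small on the cradle event**: the windowed transfer-impulse sum of any sphere is
`≤ 2 V_hi + 3 V_hi²` (each sphere takes part in at most two transfers). [folklore] -/
theorem transferImpulseSum_le (hW : Λ.WinOK) (hε : Λ.P.ε < 1 / 2) {z : Cfg N} (hz : z ∈ Λ.Ev a) (hgood : z ∈ Φ.good)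
    (p : Fin (N + 1)) :
    0 ≤ Φ.collisionSum (Set.Ioc 0 Λ.w)
        (fun c => if c.fst = p then ‖c.postVel.1 - c.preVel.1‖ + |‖c.postVel.1‖ ^ 2 - ‖c.preVel.1‖ ^ 2| / 2 else 0) z ∧
    Φ.collisionSum (Set.Ioc 0 Λ.w)
        (fun c => if c.fst = p then ‖c.postVel.1 - c.preVel.1‖ + |‖c.postVel.1‖ ^ 2 - ‖c.preVel.1‖ ^ 2| / 2 else 0) z ≤
      2 * Λ.P.Vhi + 3 * Λ.P.Vhi ^ 2 := by
  classical
  have hΛ := hW.ok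
  rw [collisionSum_window hW hε hz hgood]
  simp only [HardSphereCollisionRecord.ofConfig_fst]
  set B : ℝ := Λ.P.Vhi + 3 / 2 * Λ.P.Vhi ^ 2 with hB
  -- a sum of `≤ B` nonnegative values over transfers with a prescribed (injective) sphere label is `≤ B`
  have key : ∀ (f : (ℕ × (Fin Λ.n × Fin Λ.n) × ℕ) → Fin (N + 1)) (g : (ℕ × (Fin Λ.n × Fin Λ.n) × ℕ) → ℝ),
      (∀ tr ∈ Λ.transfers a z, ∀ tr' ∈ Λ.transfers a z, f tr = f tr' → tr = tr') →
      (∀ tr ∈ Λ.transfers a z, 0 ≤ g tr ∧ g tr ≤ B) →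
      0 ≤ ∑ tr ∈ Λ.transfers a z, (if f tr = p then g tr else 0) ∧
        ∑ tr ∈ Λ.transfers a z, (if f tr = p then g tr else 0) ≤ B := by
    intro f g hf hg
    constructor
    · exact Finset.sum_nonneg fun tr htr => by split_ifs <;> [exact (hg tr htr).1; exact le_rfl]
    · rw [← Finset.sum_filter]
      have hcard : ((Λ.transfers a z).filter fun tr => f tr = p).card ≤ 1 := by
        refine Finset.card_le_one.2 fun tr htr tr' htr' => ?_
        rw [Finset.mem_filter] at htr htr'
        exact hf tr htr.1 tr' htr'.1 (htr.2.trans htr'.2.symm)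
      have hB0 : 0 ≤ B := by have := hΛ.sep.adm.Vhi_pos; positivity
      calc ∑ tr ∈ (Λ.transfers a z).filter (fun tr => f tr = p), g tr
          ≤ ∑ tr ∈ (Λ.transfers a z).filter (fun tr => f tr = p), B :=
            Finset.sum_le_sum fun tr htr => (hg tr (Finset.mem_filter.1 htr).1).2
        _ = ((Λ.transfers a z).filter fun tr => f tr = p).card • B := Finset.sum_const _
        _ ≤ B := by
            rw [nsmul_eq_mul]
            rcases Nat.le_one_iff_eq_zero_or_eq_one.1 hcard with h | h <;> rw [h] <;> simp [hB0]
  rw [Finset.sum_add_distrib]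
  obtain ⟨h1, h2⟩ := key (Λ.sphI a) _ (fun tr htr tr' htr' h => sphI_inj hΛ htr htr' h)
    (fun tr htr => (transferValue_le hW hz htr).1)
  obtain ⟨h3, h4⟩ := key (Λ.sphJ a) _ (fun tr htr tr' htr' h => sphJ_inj hΛ htr htr' h)
    (fun tr htr => (transferValue_le hW hz htr).2)
  constructor
  · exact add_nonneg h1 h3
  · rw [hB] at h2 h4; linarith

/-- The TRANSFER activity functional of C′ (per sphere), scaled by `κ = σ/τ`. -/
def actT (Λ : EquilibriumClampedCollisionalWindowLDNegative.Lat) {N : ℕ} (Φ : HardSphereFlow (Torus.geometry (Fin 3)) Λ.P.ε (N + 1)) (κ : ℝ) (i : Fin (N + 1))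
    (z : Cfg N) : ℝ :=
  κ * Φ.collisionSum (Set.Ioc 0 Λ.w)
    (fun c => if c.fst = i then ‖c.postVel.1 - c.preVel.1‖ + |‖c.postVel.1‖ ^ 2 - ‖c.preVel.1‖ ^ 2| / 2 else 0) z

/-- The transfer clamp weight of C′. -/
def ωT (Λ : EquilibriumClampedCollisionalWindowLDNegative.Lat) {N : ℕ} (Φ : HardSphereFlow (Torus.geometry (Fin 3)) Λ.P.ε (N + 1)) (κ V : ℝ) (i : Fin (N + 1))
    (z : Cfg N) : ℝ :=
  if actT Λ Φ κ i z ≤ V then 1 else 0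

/-- The transfer-clamped energy functional `Xᵉ` of C′ with the test function `φ = cos 2π x₀`. -/
def XeT (Λ : EquilibriumClampedCollisionalWindowLDNegative.Lat) {N : ℕ} (Φ : HardSphereFlow (Torus.geometry (Fin 3)) Λ.P.ε (N + 1)) (κ V : ℝ) (z : Cfg N) : ℝ :=
  Φ.collisionSum (Set.Ioc 0 Λ.w)
    (fun c => ωT Λ Φ κ V c.fst z * ωT Λ Φ κ V c.snd z *
      ((phi c.fstPos - phi c.sndPos) * ((‖c.postVel.1‖ ^ 2 - ‖c.preVel.1‖ ^ 2) / 2)) / 2) z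

/-- The transfer clamp is inactive on the cradle event when `κ · (2 V_hi + 3 V_hi²) ≤ V`. [folklore] -/
theorem ωT_eq_one (hW : Λ.WinOK) (hε : Λ.P.ε < 1 / 2) {z : Cfg N} {a : Fin (N + 1) ≃ Λ.Slot} (hz : z ∈ Λ.Ev a)
    (hgood : z ∈ Φ.good) {κ V : ℝ} (hκ : 0 ≤ κ) (hV : κ * (2 * Λ.P.Vhi + 3 * Λ.P.Vhi ^ 2) ≤ V) (i : Fin (N + 1)) :
    ωT Λ Φ κ V i z = 1 := by
  unfold ωT actT
  rw [if_pos]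
  obtain ⟨-, h2⟩ := transferImpulseSum_le hW hε hz hgood i
  exact (mul_le_mul_of_nonneg_left h2 hκ).trans hV

/-- **Pointwise exponent bound on a labelled event** (transfer clamp). [folklore] -/
theorem exponent_geT (hW : Λ.WinOK) (hG : Λ.GainOK) (hε : Λ.P.ε < 1 / 2) (hw0 : 0 < Λ.w) {z : Cfg N}
    {a : Fin (N + 1) ≃ Λ.Slot} (hz : z ∈ Λ.Ev a) (hgood : z ∈ Φ.good) {κ V β σ Z Z' : ℝ} (hκ : 0 ≤ κ)
    (hV : κ * (2 * Λ.P.Vhi + 3 * Λ.P.Vhi ^ 2) ≤ V) (hβ : 0 ≤ β) {kw : ℕ} (hkK : kw + 1 ≤ Λ.P.K)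
    (hkw : (kw : ℝ) * Λ.P.θhi ≤ Λ.w) (hM : 24 * Λ.m ≤ Λ.M) :
    Λ.Fmin N kw β Z ≤ β * (Λ.w⁻¹ * XeT Λ Φ κ V z - Λ.w⁻¹ * Λ.AeF Φ σ Z Z' z) := by
  classical
  have hΛ := hW.ok
  have hω : ∀ i, ωT Λ Φ κ V i z = 1 := ωT_eq_one hW hε hz hgood hκ hV
  have hX := energy_lower hW hG hε hz hgood (ω := fun i => ωT Λ Φ κ V i z) hω
  have hT : Λ.Tlow kw ≤ ((Λ.transfers a z).card : ℝ) := by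
    have h1 := card_transfers_ge (a := a) hΛ hz hkK hkw
    have h2 := card_active_ge Λ hΛ hM
    have h1' : ((((Finset.range Λ.Q).filter Λ.Active).card * (Λ.n * Λ.n) * kw : ℕ) : ℝ) ≤ (Λ.transfers a z).card := by
      exact_mod_cast h1
    push_cast at h1'
    unfold Lat.Tlow
    have : (0 : ℝ) ≤ (Λ.n : ℝ) * Λ.n * kw := by positivity
    nlinarith
  have hg0 := gainT_nonneg hΛ hG
  have hwi : 0 < Λ.w⁻¹ := inv_pos.2 hw0
  have hXe : Λ.w⁻¹ * (Λ.Tlow kw * gainT Λ.P) ≤ Λ.w⁻¹ * XeT Λ Φ κ V z := by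
    refine mul_le_mul_of_nonneg_left ?_ hwi.le
    exact le_trans (mul_le_mul_of_nonneg_right hT hg0) hX
  have hA := abs_Ae_le hW hz hgood σ Z Z'
  have hAe : Λ.w⁻¹ * Λ.AeF Φ σ Z Z' z ≤
      |Z - 1| * (6 * Real.pi) * (((Λ.Q * (Λ.n * Λ.n) : ℕ) : ℝ) * Λ.P.Vhi + ((N : ℝ) + 1) * max Λ.P.u Λ.P.ρs) := by
    have h1 : Λ.AeF Φ σ Z Z' z ≤ |Z - 1| * (6 * Real.pi) *
        (((Λ.Q * (Λ.n * Λ.n) : ℕ) : ℝ) * Λ.P.Vhi + ((N : ℝ) + 1) * max Λ.P.u Λ.P.ρs) * Λ.w := (le_abs_self _).trans hA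
    calc Λ.w⁻¹ * Λ.AeF Φ σ Z Z' z ≤ Λ.w⁻¹ * (|Z - 1| * (6 * Real.pi) *
          (((Λ.Q * (Λ.n * Λ.n) : ℕ) : ℝ) * Λ.P.Vhi + ((N : ℝ) + 1) * max Λ.P.u Λ.P.ρs) * Λ.w) :=
          mul_le_mul_of_nonneg_left h1 hwi.le
      _ = _ := by field_simp
  unfold Lat.Fmin
  have := mul_le_mul_of_nonneg_left hXe hβ
  have := mul_le_mul_of_nonneg_left hAe hβ
  nlinarith

/-- **The main lower bound** (transfer clamp): the exponential moment is at least `(N+1)! · e^{Fmin} · evB`. [folklore] -/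
theorem lintegral_geT (hcardN : Fintype.card Λ.Slot = N + 1) (hW : Λ.WinOK) (hG : Λ.GainOK) (hε : Λ.P.ε < 1 / 2)
    (hr : Λ.P.r < 1 / 2) (hw0 : 0 < Λ.w) {σ : ℝ} (hσ : σ ≤ 1 / 2) (hεσ : hsDiameter σ N = Λ.P.ε)
    (hgoodP : localGibbsMeasure σ (fun _ => 1) (fun _ => 0) (fun _ => (1 : ℝ)) N Φ.goodᶜ = 0)
    {κ V β Z Z' : ℝ} (hκ : 0 ≤ κ) (hV : κ * (2 * Λ.P.Vhi + 3 * Λ.P.Vhi ^ 2) ≤ V) (hβ : 0 ≤ β) {kw : ℕ}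
    (hkK : kw + 1 ≤ Λ.P.K) (hkw : (kw : ℝ) * Λ.P.θhi ≤ Λ.w) (hM : 24 * Λ.m ≤ Λ.M) :
    ENNReal.ofReal (((N + 1).factorial : ℝ) * Real.exp (Λ.Fmin N kw β Z) * Λ.evB N) ≤
      ∫⁻ z, ENNReal.ofReal (Real.exp (β * (Λ.w⁻¹ * XeT Λ Φ κ V z - Λ.w⁻¹ * Λ.AeF Φ σ Z Z' z)))
        ∂(localGibbsMeasure σ (fun _ => 1) (fun _ => 0) (fun _ => (1 : ℝ)) N) := by
  classical
  set P := localGibbsMeasure σ (fun _ => 1) (fun _ => 0) (fun _ => (1 : ℝ)) N with hP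
  set f : Cfg N → ENNReal := fun z => ENNReal.ofReal (Real.exp (β * (Λ.w⁻¹ * XeT Λ Φ κ V z - Λ.w⁻¹ * Λ.AeF Φ σ Z Z' z)))
  set c : ENNReal := ENNReal.ofReal (Real.exp (Λ.Fmin N kw β Z)) with hc
  have hmeas : ∀ a : Fin (N + 1) ≃ Λ.Slot, MeasurableSet (Λ.Ev a : Set (Cfg N)) := fun a => measurableSet_Ev
  have hdisj : Pairwise (Function.onFun Disjoint fun a : Fin (N + 1) ≃ Λ.Slot => (Λ.Ev a : Set (Cfg N))) :=
    fun a a' h => Ev_disjoint hW h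
  have step1 : ∑ a : Fin (N + 1) ≃ Λ.Slot, ∫⁻ z in Λ.Ev a, f z ∂P ≤ ∫⁻ z, f z ∂P := by
    have h := lintegral_iUnion (μ := P) hmeas hdisj f
    rw [tsum_fintype] at h
    rw [← h]
    exact setLIntegral_le_lintegral _ _
  have step2 : ∀ a : Fin (N + 1) ≃ Λ.Slot, c * P (Λ.Ev a) ≤ ∫⁻ z in Λ.Ev a, f z ∂P := by
    intro a
    have hpt : ∀ z ∈ Λ.Ev a, (Φ.good).indicator (fun _ => c) z ≤ f z := by
      intro z hz
      by_cases hg : z ∈ Φ.good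
      · rw [Set.indicator_of_mem hg]
        exact ENNReal.ofReal_le_ofReal (Real.exp_le_exp.2
          (exponent_geT hW hG hε hw0 hz hg hκ hV hβ hkK hkw hM))
      · rw [Set.indicator_of_notMem hg]; exact bot_le
    calc c * P (Λ.Ev a) ≤ c * P (Φ.good ∩ Λ.Ev a) := by
          refine mul_le_mul' le_rfl ?_
          have hsub : (Λ.Ev a : Set (Cfg N)) ⊆ (Φ.good ∩ Λ.Ev a) ∪ Φ.goodᶜ := by
            intro z hz; by_cases hg : z ∈ Φ.good
            · exact Or.inl ⟨hg, hz⟩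
            · exact Or.inr hg
          calc P (Λ.Ev a) ≤ P ((Φ.good ∩ Λ.Ev a) ∪ Φ.goodᶜ) := measure_mono hsub
            _ ≤ P (Φ.good ∩ Λ.Ev a) + P Φ.goodᶜ := measure_union_le _ _
            _ = P (Φ.good ∩ Λ.Ev a) := by rw [hgoodP, add_zero]
      _ = ∫⁻ z in Λ.Ev a, (Φ.good).indicator (fun _ => c) z ∂P := by
          rw [lintegral_indicator_const Φ.measurableSet_good, Measure.restrict_apply Φ.measurableSet_good]
      _ ≤ ∫⁻ z in Λ.Ev a, f z ∂P := setLIntegral_mono' (hmeas a) hpt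
  have step3 : ∀ a : Fin (N + 1) ≃ Λ.Slot, c * ENNReal.ofReal (Λ.evB N) ≤ c * P (Λ.Ev a) := fun a =>
    mul_le_mul' le_rfl (measure_Ev_ge (a := a) hW hσ hεσ hr)
  have hcardE : Fintype.card (Fin (N + 1) ≃ Λ.Slot) = (N + 1).factorial := by
    have e : Fin (N + 1) ≃ Λ.Slot := Fintype.equivOfCardEq (by rw [Fintype.card_fin, hcardN])
    rw [Fintype.card_equiv e, Fintype.card_fin]
  calc ENNReal.ofReal (((N + 1).factorial : ℝ) * Real.exp (Λ.Fmin N kw β Z) * Λ.evB N)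
      = ((N + 1).factorial : ENNReal) * (c * ENNReal.ofReal (Λ.evB N)) := by
        rw [ENNReal.ofReal_mul (by positivity), ENNReal.ofReal_mul (by positivity), ENNReal.ofReal_natCast, hc,
          mul_assoc]
    _ = ∑ _a : Fin (N + 1) ≃ Λ.Slot, c * ENNReal.ofReal (Λ.evB N) := by
        rw [Finset.sum_const, Finset.card_univ, hcardE, nsmul_eq_mul]
    _ ≤ ∑ a : Fin (N + 1) ≃ Λ.Slot, ∫⁻ z in Λ.Ev a, f z ∂P :=
        Finset.sum_le_sum fun a _ => (step3 a).trans (step2 a)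
    _ ≤ _ := step1

end TransferClamp

/-- **Natural strengthening of C′ refuted: the clamp level cannot be chosen after the window.** The statement below is
`TwoClocks.ClampedTransferWindowLD` (transfer activity, all four rows, EOS projections verbatim) with the quantifier block
`∃ V₀ ∀ V ≥ V₀` moved from before `∃ β₀` to after `∀ τ ≥ τ₀`. Witness: the frozen line-lattice Newton cradle of the
refutation of stmt-13733 (`a₀ = θ₀ = 1`, `u₀ = 0`, `σ = (4/5)/l²`, `φ = cos 2π x₀`, `β = β₀`, `ε = 1`, `τ = t⁴`,
`N + 1 = (l n)³`) run at clamp level `V = max V₀ ((σ/τ)(2V_hi + 3V_hi²))` (`V_hi = V_hi(l,t)` the pulse speed bound), at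
which every sphere passes the TRANSFER clamp (`transferImpulseSum_le`), so the energy row is `≥ (N+1)! e^{F_min} evB > e^{N+1}`.
Hence in C′ the dependence `β₀ = β₀(V)` is essential: `β₀(V) · V` must stay bounded up to logarithms. [folklore] -/
theorem not_clampedTransferWindowLD_clampAfterWindow :
    ¬ (∃ σ₀ : ℝ, 0 < σ₀ ∧ ∀ (a₀ θ₀ : ℝ) (u₀ : Literature.MathematicalPhysics.KineticTheory.V3), 0 < a₀ → 0 < θ₀ → ∀ σ : ℝ, 0 < σ → σ < σ₀ → ∀ Φ : (N : ℕ) → Literature.Analysis.FluidPDE.HardSphereFlow (Literature.Analysis.FluidPDE.Torus.geometry (Fin 3)) (Literature.MathematicalPhysics.KineticTheory.hsDiameter σ N) (N + 1), ∀ φ : Literature.MathematicalPhysics.KineticTheory.T3 → ℝ, Literature.Analysis.FunctionSpaces.Torus.IsSmooth φ → ∃ β₀ : ℝ, 0 < β₀ ∧ ∀ β : ℝ, |β| ≤ β₀ → ∀ ε : ℝ, 0 < ε → ∃ τ₀ : ℝ, 0 < τ₀ ∧ ∀ τ : ℝ, τ₀ ≤ τ → ∃ V₀ : ℝ, 0 <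 V₀ ∧ ∀ V : ℝ, V₀ ≤ V → ∃ N₀ : ℕ, ∀ N : ℕ, N₀ ≤ N → (let w : ℝ := τ * ((N : ℝ) + 1) ^ (-(1 / 3 : ℝ)); let P := Literature.MathematicalPhysics.KineticTheory.localGibbsLaw σ (fun _ => a₀) (fun _ => u₀) (fun _ => θ₀) N (Φ N); let Z : ℝ := Literature.MathematicalPhysics.KineticTheory.hsCompressibility (σ ^ 3); let Z' : ℝ := deriv Literature.MathematicalPhysics.KineticTheory.hsCompressibility (σ ^ 3); let act := fun (i : Fin (N + 1)) (z : Literature.Analysis.FluidPDE.Config (N + 1) (Fin 3) Literature.MathematicalPhysics.KineticTheory.T3) => σ / τ * (Φ N).collisionSum (Set.Ioc 0 w) (fun c => if c.fst = i then ‖c.postVel.1 - c.preVel.1‖ + |‖c.postVel.1‖ ^ 2 - ‖c.preVel.1‖ ^ 2| / 2 else 0) z; let ω := fun (i : Fin (N + 1)) (z : Literature.Analysis.FluidPDE.Config (N + 1) (Fin 3) Literature.MathematicalPhysics.KineticTheory.T3) => if act i z ≤ V then (1 : ℝ) else 0; let Xm := fun (k : Fin 3) (z : Literature.Analysis.FluidPDE.Config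 (N + 1) (Fin 3) Literature.MathematicalPhysics.KineticTheory.T3) => (Φ N).collisionSum (Set.Ioc 0 w) (fun c => ω c.fst z * ω c.snd z * ((φ c.fstPos - φ c.sndPos) * (c.postVel.1 k - c.preVel.1 k)) / 2) z; let Am := fun (k : Fin 3) (z : Literature.Analysis.FluidPDE.Config (N + 1) (Fin 3) Literature.MathematicalPhysics.KineticTheory.T3) => ∫ r in (0 : ℝ)..w, ∑ i, Literature.Analysis.FunctionSpaces.Torus.partialDeriv k φ ((Φ N).flow r z i).1 * (θ₀ * σ ^ 3 * Z' + (1 / 3) * (Z - 1) * ‖((Φ N).flow r z i).2 - u₀‖ ^ 2); let Xe := fun (z : Literature.Analysis.FluidPDE.Config (N + 1) (Fin 3) Literature.MathematicalPhysics.KineticTheory.T3) => (Φ N).collisionSum (Set.Ioc 0 w) (fun c => ω c.fst z * ω c.snd z * ((φ c.fstPos - φ c.sndPos) * ((‖c.postVel.1‖ ^ 2 - ‖c.preVel.1‖ ^ 2) / 2)) / 2) z; let Ae := fun (z : Literature.Analysis.FluidPDE.Config (N + 1) (Fin 3) Literature.MathematicalPhysics.KineticTheory.T3) => ∫ r in (0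 : ℝ)..w, ∑ i, ((∑ l, u₀ l * Literature.Analysis.FunctionSpaces.Torus.partialDeriv l φ ((Φ N).flow r z i).1) * (θ₀ * σ ^ 3 * Z' + (1 / 3) * (Z - 1) * ‖((Φ N).flow r z i).2 - u₀‖ ^ 2) + θ₀ * (Z - 1) * (∑ l, Literature.Analysis.FunctionSpaces.Torus.partialDeriv l φ ((Φ N).flow r z i).1 * (((Φ N).flow r z i).2 - u₀) l)); (∀ k : Fin 3, ∫⁻ z, ENNReal.ofReal (Real.exp (β * (w⁻¹ * Xm k z - w⁻¹ * Am k z))) ∂P ≤ ENNReal.ofReal (Real.exp (ε * ((N : ℝ) + 1)))) ∧ ∫⁻ z, ENNReal.ofReal (Real.exp (β * (w⁻¹ * Xe z - w⁻¹ * Ae z))) ∂P ≤ ENNReal.ofReal (Real.exp (ε * ((N : ℝ) + 1))))) := by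
  classical
  rintro ⟨σ₀, hσ₀, H⟩
  obtain ⟨l, hl, hlσ⟩ : ∃ l : ℕ, 2 ≤ l ∧ (4 / 5 : ℝ) / (l : ℝ) ^ 2 < σ₀ := by
    refine ⟨⌈1 / σ₀⌉₊ + 2, by omega, ?_⟩
    have h1 : 1 / σ₀ ≤ ⌈1 / σ₀⌉₊ := Nat.le_ceil _
    have hl2 : (1 / σ₀ : ℝ) + 2 ≤ ((⌈1 / σ₀⌉₊ + 2 : ℕ) : ℝ) := by push_cast; linarith
    have hpos : 0 < 1 / σ₀ := by positivity
    set L : ℝ := ((⌈1 / σ₀⌉₊ + 2 : ℕ) : ℝ)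
    have hL : 1 / σ₀ < L := by linarith
    have hL1 : 1 ≤ L := by linarith
    rw [div_lt_iff₀ (by positivity)]
    have : 1 < σ₀ * L := by rwa [div_lt_iff₀' hσ₀] at hL
    nlinarith
  set σ : ℝ := (4 / 5) / (l : ℝ) ^ 2 with hσdef
  have hl0 : (0 : ℝ) < l := by exact_mod_cast (show 0 < l by omega)
  have hl2 : (2 : ℝ) ≤ l := by exact_mod_cast hl
  have hσ : 0 < σ := by positivity
  have hσ5 : σ ≤ 1 / 5 := by
    rw [hσdef, div_le_iff₀ (by positivity)]; nlinarith
  have hσ2 : σ < 1 / 2 := by linarith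
  specialize H 1 1 (0 : V3) one_pos one_pos σ hσ hlσ (flowFam hσ hσ2) phi isSmooth_phi
  obtain ⟨β₀, hβ₀, H⟩ := H
  specialize H β₀ (by rw [abs_of_pos hβ₀]) 1 one_pos
  obtain ⟨τ₀, hτ₀, H⟩ := H
  set Z : ℝ := hsCompressibility (σ ^ 3) with hZ
  set Z' : ℝ := deriv hsCompressibility (σ ^ 3) with hZ'
  obtain ⟨t, ht, hτt, hbig⟩ : ∃ t : ℕ, 24 * l ^ 2 ≤ t ∧ τ₀ ≤ (t : ℝ) ^ 4 ∧
      39 * (l : ℝ) ^ 2 * (224 + 6 * l + 40 * β₀ * |Z - 1|) ≤ β₀ * t := by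
    set X : ℝ := 39 * (l : ℝ) ^ 2 * (224 + 6 * l + 40 * β₀ * |Z - 1|) / β₀ with hX
    refine ⟨⌈τ₀⌉₊ + 24 * l ^ 2 + ⌈X⌉₊ + 1, by omega, ?_, ?_⟩
    · have h1 : τ₀ ≤ ⌈τ₀⌉₊ := Nat.le_ceil _
      have h2 : (⌈τ₀⌉₊ : ℝ) ≤ ((⌈τ₀⌉₊ + 24 * l ^ 2 + ⌈X⌉₊ + 1 : ℕ) : ℝ) := by exact_mod_cast (by omega)
      have h3 : (1 : ℝ) ≤ ((⌈τ₀⌉₊ + 24 * l ^ 2 + ⌈X⌉₊ + 1 : ℕ) : ℝ) := by exact_mod_cast (by omega)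
      calc τ₀ ≤ ((⌈τ₀⌉₊ + 24 * l ^ 2 + ⌈X⌉₊ + 1 : ℕ) : ℝ) := h1.trans h2
        _ = ((⌈τ₀⌉₊ + 24 * l ^ 2 + ⌈X⌉₊ + 1 : ℕ) : ℝ) ^ 1 := (pow_one _).symm
        _ ≤ _ := pow_le_pow_right₀ h3 (by norm_num)
    · have h1 : X ≤ ⌈X⌉₊ := Nat.le_ceil _
      have h2 : (⌈X⌉₊ : ℝ) ≤ ((⌈τ₀⌉₊ + 24 * l ^ 2 + ⌈X⌉₊ + 1 : ℕ) : ℝ) := by exact_mod_cast (by omega)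
      have h3 : X ≤ ((⌈τ₀⌉₊ + 24 * l ^ 2 + ⌈X⌉₊ + 1 : ℕ) : ℝ) := h1.trans h2
      have := mul_le_mul_of_nonneg_left h3 hβ₀.le
      rw [hX, mul_div_cancel₀ _ hβ₀.ne'] at this
      exact this
  specialize H ((t : ℝ) ^ 4) hτt
  -- NOW the clamp level is chosen, after `τ = t⁴`: above the transfer activity of every relay sphere
  obtain ⟨V₀, hV₀, H⟩ := H
  set Vc : ℝ := max V₀ (σ / (t : ℝ) ^ 4 * (2 * (bpar l t).Vhi + 3 * (bpar l t).Vhi ^ 2)) with hVc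
  specialize H Vc (le_max_left _ _)
  obtain ⟨N₀, H⟩ := H
  set n : ℕ := N₀ + 18 * t ^ 7 * l ^ 2 + 10 with hn
  have hn2 : 2 ≤ n := by omega
  have hn1 : 1 ≤ n := by omega
  set N : ℕ := (l * n) ^ 3 - 1 with hNdef
  have hln : 1 ≤ l * n := Nat.mul_pos (by omega) (by omega)
  have hN : N + 1 = (l * n) ^ 3 := by
    have : 1 ≤ (l * n) ^ 3 := Nat.one_le_pow _ _ hln; omega
  have hN₀ : N₀ ≤ N := by
    have h1 : l * n ≤ (l * n) ^ 3 := by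
      calc l * n = (l * n) ^ 1 := (pow_one _).symm
        _ ≤ (l * n) ^ 3 := Nat.pow_le_pow_right hln (by norm_num)
    have h2 : n ≤ l * n := Nat.le_mul_of_pos_left n (by omega)
    omega
  specialize H N hN₀
  obtain ⟨-, hE⟩ := H
  set Λ := LatW' l n t with hΛ
  have hΛeq : Λ = LatW l n t := LatW'_eq hl hn1
  have hcard : Fintype.card Λ.Slot = N + 1 := by rw [hΛeq, LatW.card_slot, hN]
  have hchart : 4 * (6 * (t : ℝ) ^ 7 * (l : ℝ) ^ 2 + 4) ≤ (l : ℝ) ^ 3 * n := by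
    have hn' : ((18 * t ^ 7 * l ^ 2 + 10 : ℕ) : ℝ) ≤ n := by exact_mod_cast (by omega)
    push_cast at hn'
    have hl8 : (8 : ℝ) ≤ (l : ℝ) ^ 3 := by
      have := pow_le_pow_left₀ (by norm_num : (0:ℝ) ≤ 2) hl2 3; norm_num at this; exact this
    have h0 : (0 : ℝ) ≤ (t : ℝ) ^ 7 * (l : ℝ) ^ 2 := by positivity
    have h1 : (8 : ℝ) * n ≤ (l : ℝ) ^ 3 * n := mul_le_mul_of_nonneg_right hl8 (by positivity)
    nlinarith
  have hW : Λ.WinOK := by rw [hΛeq]; exact LatW.winOK hl ht hn1 hchart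
  have hG : Λ.GainOK := by rw [hΛeq]; exact LatW.gainOK hl ht hn1
  obtain ⟨hε12, hr12, -⟩ : Λ.P.ε < 1 / 2 ∧ Λ.P.r < 1 / 2 ∧ (4 / 5 : ℝ) / (l : ℝ) ^ 2 ≤ 1 / 2 := by
    rw [hΛeq]; exact LatW.small_facts hl ht hn1
  have hn0 : (0:ℝ) < n := by exact_mod_cast (show 0 < n by omega)
  have hT := bpar.Tpos hl ht
  have hc := LatW.c_pos (l := l) (n := n) hl hn1
  have hw0 : 0 < Λ.w := by show 0 < cscale l n * ((t : ℝ) ^ 4 * (l : ℝ) ^ 2); positivity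
  have hεσ : hsDiameter σ N = Λ.P.ε := rfl
  have hgoodP : localGibbsMeasure σ (fun _ => 1) (fun _ => 0) (fun _ => (1 : ℝ)) N (flowFam hσ hσ2 N).goodᶜ = 0 :=
    localGibbsMeasure_absolutelyContinuous σ _ _ _ N (flowFam hσ hσ2 N) (flowFam hσ hσ2 N).measure_compl_good
  have hκ : 0 ≤ σ / (t : ℝ) ^ 4 := by positivity
  have hVcl : σ / (t : ℝ) ^ 4 * (2 * Λ.P.Vhi + 3 * Λ.P.Vhi ^ 2) ≤ Vc := by
    refine le_trans (le_of_eq ?_) (le_max_right _ _)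
    rw [hΛeq, LatW.P_eq, Params.scale_Vhi _ hc.ne']
  obtain ⟨-, -, -, w4, w5, -⟩ := bpar.win_facts hl ht
  have hkK : 4 * t ^ 7 * l ^ 2 + 1 ≤ Λ.P.K := by rw [hΛeq]; exact w5
  have hkw : ((4 * t ^ 7 * l ^ 2 : ℕ) : ℝ) * Λ.P.θhi ≤ Λ.w := by
    rw [hΛeq, LatW.P_eq, Params.scale_θhi _ hc.ne', LatW.w_eq]
    calc ((4 * t ^ 7 * l ^ 2 : ℕ) : ℝ) * (cscale l n * (bpar l t).θhi)
        = cscale l n * (((4 * t ^ 7 * l ^ 2 : ℕ) : ℝ) * (bpar l t).θhi) := by ring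
      _ ≤ cscale l n * ((t : ℝ) ^ 4 * (l : ℝ) ^ 2) := mul_le_mul_of_nonneg_left w4 hc.le
  have hM : 24 * Λ.m ≤ Λ.M := by
    show 24 * (6 * t ^ 7 * l ^ 2 + 3) ≤ l ^ 3 * n
    have hl8 : 8 ≤ l ^ 3 := by
      calc 8 = 2 ^ 3 := by norm_num
        _ ≤ l ^ 3 := Nat.pow_le_pow_left hl 3
    have hn' : 18 * t ^ 7 * l ^ 2 + 10 ≤ n := by omega
    calc 24 * (6 * t ^ 7 * l ^ 2 + 3) = 8 * (18 * t ^ 7 * l ^ 2 + 9) := by ring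
      _ ≤ l ^ 3 * n := Nat.mul_le_mul hl8 (by omega)
  have key := lintegral_geT (Λ := Λ) (Φ := flowFam hσ hσ2 N) hcard hW hG hε12 hr12 hw0 (by linarith) hεσ hgoodP
    (V := Vc) (Z := Z) (Z' := Z') hκ hVcl hβ₀.le hkK hkw hM
  have hfin := LatW.final_ineq hl ht hn2 hN hβ₀ Z hbig
  rw [← hΛeq] at hfin
  have hlt : ENNReal.ofReal (Real.exp (1 * ((N : ℝ) + 1))) <
      ENNReal.ofReal (((N + 1).factorial : ℝ) * Real.exp (Λ.Fmin N (4 * t ^ 7 * l ^ 2) β₀ Z) * Λ.evB N) := by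
    rw [one_mul, ENNReal.ofReal_lt_ofReal_iff (lt_trans (Real.exp_pos _) hfin)]
    exact hfin
  have hw : (t : ℝ) ^ 4 * ((N : ℝ) + 1) ^ (-(1 / 3 : ℝ)) = Λ.w := by
    rw [LatW.w_eq_stmt (t := t) hl hn1 hN, hΛeq]
  simp only [] at hE
  rw [localGibbsLaw_eq, hw] at hE
  exact absurd (lt_of_lt_of_le hlt (key.trans hE)) (lt_irrefl _)

end Summit.AtomisticToContinuum.HydrodynamicLimit.Theorems.ClampedTransferWindowLDNegative

end
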